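import Literature.Probability.RandomPlanarGeometry.LoewnerRegularCurves
import Literature.Probability.RandomPlanarGeometry.DrivingProcessWeakLimitVarying
import Literature.Probability.RandomPlanarGeometry.LoewnerTipModulus
import Literature.Probability.RandomPlanarGeometry.LoewnerHullCapacity
import Literature.Probability.RandomPlanarGeometry.HalfPlaneFill
import HarnessLib

/-!
# Regular curves lie in Kemppainen–Smirnov boxes; the main theorem in approximating domains

Topic `Literature/Probability/RandomPlanarGeometry` (family `crit-ising`); theorems only (no
definition, no named fact). This file joins the two tree forms of the deterministic half of

* A. Kemppainen, S. Smirnov, *Random curves, scaling limits and Loewner evolutions*, Ann.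
  Probab. 45 (2017) 698–779, §3.5 "Proof of the main theorem" with App. A, Lemma A.5
  (arXiv:1212.6215: §3.5 p. 18, Lemma 5.7),

namely the EVENT form `regularCurves φ 𝔯` of `LoewnerRegularCurves.lean` (KS's `E ∩ X_simple`:
transience index at `b`, capacity schedule, moduli of the driving term, localised tip modulus —
fixed domain) and the BOX form of `LoewnerTransformContinuity.lean` /
`DrivingProcessWeakLimitVarying.lean` (compact sets of Loewner pairs `(γ̂, W)` with prescribed
moduli of `γ̂`, `W` and a prescribed transience profile — fixed AND approximating domains), and
thereby extends the event form to approximating domains `(D_n; a_n, b_n) → (D; a, b)` read through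
their own uniformizing maps `φ_n` (KS Cor. 1.8; the setting of Chelkak–Duminil-Copin–Hongler–
Kemppainen–Smirnov, C. R. Math. 352 (2014), §3: "conformal maps `φ^δ` from `Ω^δ` onto `ℍ` …
`φ^δ → φ`", Thm. 3: the driving process `w^δ` of the discrete curve through the discrete map).

* `Loewner.exists_modulusSet_of_tipModulus_levels` — the tip-structure ⟹ curve-modulus lemma of
  `LoewnerTipModulus.lean` (KS Lemma A.5, first step) with a tip modulus and a depth depending
  on the level `[0, k+1]` (the form delivered by a LOCALISED tip modulus, KS Thm. 3.10);
* `Loewner.IsGeneratedByCurve.exists_lt_norm_of_lt` — a generating curve leaves the disc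
  `B̄(0, R)` before capacity time `144 R² <  t` (`hcap K_t = 2t ≤ 288 R²` for hulls in a disc of
  radius `R`, `Loewner.two_mul_le_of_hull_subset_closedBall`);
* uniform behaviour of the boundary extensions `Φ_n` of the maps `φ_n` AT INFINITY
  (`dist (Φ_n z) b_n < ρ` for `‖z‖ ≥ R(ρ)`, all `n`) and their uniform PROPERNESS
  (`dist (Φ_n z) b_n ≥ ρ(R) > 0` for `‖z‖ ≤ R`, all `n`), for one map
  (`exists_forall_dist_boundaryExtension_lt`, `exists_forall_le_dist_boundaryExtension`:
  Carathéodory, `Φ z ≠ b` on `ℍ̄`) and for a family whose boundary extensions converge uniformly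
  on the compacts `{0 ≤ im} ∩ closedBall 0 R` and uniformly at infinity with `b_n → b`
  (`…_of_tendstoUniformlyOn`: the hypotheses (U1), (U2) of
  `ae_isLoewnerDescribable_and_tendstoInDistribution_drivingPath_varying`);
* `IsRegularCurve.trace_noReturn` — the transience clause of a regular curve (KS Prop. 3.2 (i),
  `N₀ ≤ N`, stated on the `[0, 1]`-parametrisation) read in CAPACITY TIME on the trace through
  the capacity clock of `SimpleCurveLoewner.lean`;
* **`exists_pairBox_of_regularCurves`** — for every regularity `𝔯` and every family of chordal
  uniformizing maps with the two uniform properties there is ONE box (moduli `δγ, δW`,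
  transience profile `T`) such that, for all `n`, `regularCurves (φ_n) 𝔯 ⊆ ⟦Φ_n ∘ pr₁⟧ '' box`:
  `δW` from the driving moduli; `δγ` from the tip modulus localised by the capacity schedule
  (before capacity `k+2` the curve is `capRad (k+2)`-far from `b_n`, so the tip modulus of a
  radius `tipRad j < capRad (k+2)` applies on `[0, k+1]`) and `exists_modulusSet_of_tipModulus_levels`;
  `T` from uniform properness + uniform behaviour at infinity + no return + the capacity bound;
  `regularCurves_subset_image_pairBox` is the fixed-domain case;
* **`ae_isLoewnerDescribable_and_tendstoInDistribution_of_regularCurves_varying`** — KS Thm. 1.5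
  (ii)–(iii) with Cor. 1.7–1.8 in the event form for approximating domains: if the boundary
  extensions converge ((U1), (U2), `b_n → b`), `μs n → ν` weakly, and for every `ε > 0` some
  `regularCurves (φ_n) 𝔯` has `μs n`-mass `≥ 1 - ε` for all `n` (KS Prop. 3.2 / Thms. 3.9–3.10
  for the family `(φ_n, μs n)` — the probabilistic half, NOT here), then `ν`-a.e. curve class is
  describable through `φ` and the discrete driving processes `W(φ_n⁻¹ γ)` converge in law to the
  driving function under `ν` (the fixed-domain statement is
  `ae_isLoewnerDescribable_and_tendstoInDistribution_of_regularCurves`).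

## References

* A. Kemppainen, S. Smirnov, Ann. Probab. 45 (2017) 698–779: §3.1 Prop. 3.2, §3.5, Thm. 1.5,
  Cor. 1.7, Cor. 1.8, App. A Lemma A.5 (arXiv:1212.6215: Prop. 3.2, §3.5 p. 18, Thm. 1.3,
  Cor. 1.5, Cor. 1.6, Lemma 5.7). [KemppainenSmirnov2017]
* D. Chelkak, H. Duminil-Copin, C. Hongler, A. Kemppainen, S. Smirnov, C. R. Math. Acad. Sci.
  Paris 352 (2014) 157–161, Thm. 3 and §3. [CDHKSCRAS2014]
* G. F. Lawler, *Conformally Invariant Processes in the Plane* (2005), §3.4 (3.9), §4.1 Thm. 4.6.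
  [Lawler2005]
* Ch. Pommerenke, *Boundary Behaviour of Conformal Maps* (1992), Thm. 2.6. [PommerenkeBBCM1992]
-/

noncomputable section

open MeasureTheory Filter Topology Set Metric Bornology Function
open UpperHalfPlane (upperHalfPlaneSet)
open scoped NNReal ENNReal BoundedContinuousFunction unitInterval

namespace Literature.Probability.RandomPlanarGeometry

open scoped PathBorel

/-! ### The curve modulus from level-dependent tip moduli -/

namespace Loewner

/-- **The common modulus of the curves from the moduli of the driving terms and LEVEL-DEPENDENT
tip moduli** (box form; `exists_modulusSet_of_tipModulus` with the tip modulus `ψ k` and the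
depth `y₀ k` allowed to depend on the level `[0, k+1]`, which is what a tip modulus localised
away from the target provides). Given `δW k > 0`, tip moduli `ψ k → 0` at `0⁺` and depths
`y₀ k > 0`, there are `δγ k > 0` such that every `γ̂` with `γ̂ 0 = 0` whose continuous driving
term `W` has the moduli `δW` (`Process.modulusSet {0} δW`) and whose tip structure satisfies
`‖f_s(W s + iy) - γ̂ s‖ ≤ ψ k y` for `s ≤ k+1`, `0 < y ≤ y₀ k`, has the moduli `δγ`.
[cite: KemppainenSmirnov2017, Prop. 3.2 and App. A Lemma A.5] -/
theorem exists_modulusSet_of_tipModulus_levels {δW : ℕ → ℝ} (hδW : ∀ k, 0 < δW k)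
    {ψ : ℕ → ℝ → ℝ} (hψ : ∀ k, Tendsto (ψ k) (𝓝[>] 0) (𝓝 0)) {y₀ : ℕ → ℝ}
    (hy₀ : ∀ k, 0 < y₀ k) :
    ∃ δγ : ℕ → ℝ, (∀ k, 0 < δγ k) ∧ ∀ (W : C(ℝ≥0, ℝ)) (γ : C(ℝ≥0, ℂ)),
      W ∈ Process.modulusSet ({0} : Set ℝ) δW →
      (∀ (k : ℕ) (s : ℝ≥0), (s : ℝ) ≤ k + 1 → ∀ y : ℝ, 0 < y → y ≤ y₀ k →
        ‖loewnerInv W s ((W s : ℂ) + y * Complex.I) - γ s‖ ≤ ψ k y) →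
      γ 0 = 0 → γ ∈ Process.modulusSet ({0} : Set ℂ) δγ := by
  -- one scale per level `k`: horizon `k+1`, tip modulus `ψ k`, depth `y₀ k`, target `1/(k+1)`
  have hk : ∀ k : ℕ, ∃ y η lam : ℝ, 0 < y ∧ y ≤ y₀ k ∧ 0 < η ∧ 0 < lam ∧
      ∀ (W : ℝ≥0 → ℝ), Continuous W → ∀ γ : ℝ≥0 → ℂ,
        (∀ s : ℝ≥0, s ≤ (k : ℝ≥0) + 1 →
          ‖loewnerInv W s ((W s : ℂ) + y * Complex.I) - γ s‖ ≤ ψ k y) →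
        ∀ t t' : ℝ≥0, t ≤ (k : ℝ≥0) + 1 → t' ≤ (k : ℝ≥0) + 1 → dist t t' ≤ η →
          |W t - W t'| ≤ lam → dist (γ t) (γ t') ≤ 1 / ((k : ℝ) + 1) := fun k ↦
    exists_scale_of_tipModulus ((k : ℝ≥0) + 1) (hψ k) (hy₀ k) (by positivity)
  choose y η lam hy hyy₀ hη hlam hscale using hk
  -- a level `j k ≥ k` whose driver bound `1/(j+1)` is below the threshold `lam k`
  have hj : ∀ k : ℕ, ∃ j : ℕ, k ≤ j ∧ 1 / ((j : ℝ) + 1) ≤ lam k := by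
    intro k
    obtain ⟨j₀, hj₀⟩ := exists_nat_one_div_lt (hlam k)
    refine ⟨max k j₀, le_max_left _ _, le_trans ?_ hj₀.le⟩
    gcongr
    exact_mod_cast le_max_right k j₀
  choose j hjk hjlam using hj
  refine ⟨fun k ↦ min (η k) (δW (j k)), fun k ↦ lt_min (hη k) (hδW (j k)), ?_⟩
  intro W γ hWmod htip hγ0
  refine ⟨by simpa using hγ0, fun k s t hs ht hst ↦ ?_⟩
  have hsT : s ≤ (k : ℝ≥0) + 1 := by
    have : ((s : ℝ≥0) : ℝ) ≤ ((k : ℝ≥0) + 1 : ℝ≥0) := by push_cast; exact hs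
    exact_mod_cast this
  have htT : t ≤ (k : ℝ≥0) + 1 := by
    have : ((t : ℝ≥0) : ℝ) ≤ ((k : ℝ≥0) + 1 : ℝ≥0) := by push_cast; exact ht
    exact_mod_cast this
  have hsj : (s : ℝ) ≤ (j k : ℝ) + 1 := hs.trans (by exact_mod_cast Nat.succ_le_succ (hjk k))
  have htj : (t : ℝ) ≤ (j k : ℝ) + 1 := ht.trans (by exact_mod_cast Nat.succ_le_succ (hjk k))
  have hWst : |W s - W t| ≤ lam k := by
    have h := hWmod.2 (j k) s t hsj htj (hst.trans (min_le_right _ _))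
    rw [Real.dist_eq] at h
    exact h.trans (hjlam k)
  exact hscale k W W.continuous γ
    (fun u hu ↦ htip k u (by exact_mod_cast hu) (y k) (hy k) (hyy₀ k))
    s t hsT htT (hst.trans (min_le_left _ _)) hWst

/-! ### A generating curve leaves every disc in bounded capacity time -/

variable {W : ℝ≥0 → ℝ} {γ : ℝ≥0 → ℂ}

/-- If the generating curve stays in `B̄(0, R)` up to time `t`, so does the hull `K_t` (far points
of `ℍ` lie in the unbounded component of `ℍ ∖ γ[0, t]`, `diff_closedBall_subset_unboundedComponent`).
[cite: Lawler2005, §4.1] -/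
theorem IsGeneratedByCurve.hull_subset_closedBall (hgen : IsGeneratedByCurve W γ) {t : ℝ≥0}
    {R : ℝ} (h : ∀ s ≤ t, ‖γ s‖ ≤ R) : hull W t ⊆ closedBall (0 : ℂ) R := by
  have hS : γ '' Icc 0 t ⊆ closedBall (0 : ℂ) R := by
    rintro _ ⟨s, hs, rfl⟩
    exact mem_closedBall_zero_iff.2 (h s hs.2)
  intro z hz
  rw [hgen.hull_eq] at hz
  by_contra hzR
  exact hz.2 (diff_closedBall_subset_unboundedComponent hS ⟨hz.1, hzR⟩)

/-- **A generating curve leaves `B̄(0, R)` before capacity time `t` whenever `144 R² < t`**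
(`hcap K_t = 2t ≤ 288 R²` for a hull inside a disc of radius `R`,
`two_mul_le_of_hull_subset_closedBall`). [cite: Lawler2005, §3.4 (3.9) and §4.1 Thm. 4.6] -/
theorem IsGeneratedByCurve.exists_lt_norm_of_lt (hW : Continuous W) (hgen : IsGeneratedByCurve W γ)
    {R : ℝ} (hR : 0 < R) {t : ℝ≥0} (ht : 144 * R ^ 2 < (t : ℝ)) : ∃ s ≤ t, R < ‖γ s‖ := by
  by_contra hcon
  push Not at hcon
  have hsub : hull W t ⊆ closedBall (((0 : ℝ) : ℂ)) R := by
    rw [Complex.ofReal_zero]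
    exact hgen.hull_subset_closedBall hcon
  have h2 := two_mul_le_of_hull_subset_closedBall hW hR hsub
  linarith

end Loewner

/-! ### Boundary extensions of chordal uniformizing maps: behaviour at infinity and properness -/

namespace MarkedDomain.IsChordalUniformizing

variable {D : DobrushinDomain} {φ : ConformalEquiv upperHalfPlaneSet D.carrier}

/-- **Uniform behaviour at infinity**: for every `ρ > 0` there is `R` with
`dist (Φ z) b < ρ` for all `z` of the closed half-plane with `‖z‖ ≥ R` (`Φ z → b` as `z → ∞`).
[cite: PommerenkeBBCM1992, Thm. 2.6] -/
theorem exists_forall_dist_boundaryExtension_lt (hφ : D.IsChordalUniformizing φ) {ρ : ℝ}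
    (hρ : 0 < ρ) : ∃ R : ℝ, ∀ z : ℂ, 0 ≤ z.im → R ≤ ‖z‖ →
      dist (φ.boundaryExtension z) (D.pt 1) < ρ := by
  have h' : ∀ᶠ z in cocompact ℂ ⊓ 𝓟 {z : ℂ | 0 ≤ z.im}, dist (φ.boundaryExtension z) (D.pt 1) < ρ :=
    Metric.tendsto_nhds.1 (tendsto_boundaryExtension_cocompact hφ) ρ hρ
  rw [(hasBasis_cocompact.inf_principal _).eventually_iff] at h'
  obtain ⟨K, hK, hKρ⟩ := h'
  obtain ⟨R, hR⟩ := hK.isBounded.subset_closedBall 0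
  refine ⟨R + 1, fun z hzim hz ↦ hKρ ⟨fun hzK ↦ ?_, hzim⟩⟩
  have := mem_closedBall_zero_iff.1 (hR hzK)
  linarith

/-- **Properness**: for every `R` there is `ρ > 0` with `dist (Φ z) b ≥ ρ` for all `z` of the
closed half-plane with `‖z‖ ≤ R` (`Φ` is continuous on the compact closed half-disc and does not
take the value `b` there, `boundaryExtension_ne_pt_one`). [cite: PommerenkeBBCM1992, Thm. 2.6] -/
theorem exists_forall_le_dist_boundaryExtension (hφ : D.IsChordalUniformizing φ) (R : ℝ) :
    ∃ ρ : ℝ, 0 < ρ ∧ ∀ z : ℂ, 0 ≤ z.im → ‖z‖ ≤ R → ρ ≤ dist (φ.boundaryExtension z) (D.pt 1) := by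
  set B : Set ℂ := closedBall (0 : ℂ) R ∩ {z : ℂ | 0 ≤ z.im} with hB
  have hBc : IsCompact B :=
    (isCompact_closedBall 0 R).inter_right (isClosed_le continuous_const Complex.continuous_im)
  have hcont : ContinuousOn (fun z ↦ dist (φ.boundaryExtension z) (D.pt 1)) B :=
    (continuous_id.dist continuous_const).comp_continuousOn
      ((continuousOn_boundaryExtension_im_nonneg φ).mono inter_subset_right)
  by_cases hne : B.Nonempty
  · obtain ⟨z₀, hz₀, hmin⟩ := hBc.exists_isMinOn hne hcont
    have hpos : 0 < dist (φ.boundaryExtension z₀) (D.pt 1) :=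
      dist_pos.2 (boundaryExtension_ne_pt_one JordanDomain.exists_continuousOn_extension_holds
        hφ hz₀.2)
    exact ⟨_, hpos, fun z hzim hz ↦ (isMinOn_iff.1 hmin) z ⟨mem_closedBall_zero_iff.2 hz, hzim⟩⟩
  · refine ⟨1, one_pos, fun z hzim hz ↦ (hne ⟨z, mem_closedBall_zero_iff.2 hz, hzim⟩).elim⟩

end MarkedDomain.IsChordalUniformizing

/-! ### Families of uniformizing maps: the two uniform properties from (U1), (U2) -/

section Family

/-- Finitely many thresholds can be chosen simultaneously (upward-closed properties). [folklore] -/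
theorem exists_forall_lt_of_forall_exists_of_monotone {P : ℕ → ℝ → Prop}
    (hmono : ∀ n R R', R ≤ R' → P n R → P n R') (h : ∀ n, ∃ R, P n R) (N : ℕ) :
    ∃ R, ∀ n < N, P n R := by
  induction N with
  | zero => exact ⟨0, fun n hn ↦ (Nat.not_lt_zero n hn).elim⟩
  | succ N ih =>
    obtain ⟨R, hR⟩ := ih
    obtain ⟨R', hR'⟩ := h N
    refine ⟨max R R', fun n hn ↦ ?_⟩
    rcases Nat.lt_succ_iff_lt_or_eq.1 hn with hlt | rfl
    · exact hmono n R _ (le_max_left _ _) (hR n hlt)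
    · exact hmono _ R' _ (le_max_right _ _) hR'

/-- Finitely many positive thresholds can be chosen simultaneously (downward-closed properties).
[folklore] -/
theorem exists_pos_forall_lt_of_forall_exists_of_antitone {P : ℕ → ℝ → Prop}
    (hanti : ∀ n ρ ρ', ρ' ≤ ρ → P n ρ → P n ρ') (h : ∀ n, ∃ ρ, 0 < ρ ∧ P n ρ) (N : ℕ) :
    ∃ ρ, 0 < ρ ∧ ∀ n < N, P n ρ := by
  induction N with
  | zero => exact ⟨1, one_pos, fun n hn ↦ (Nat.not_lt_zero n hn).elim⟩
  | succ N ih =>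
    obtain ⟨ρ, hρ, hP⟩ := ih
    obtain ⟨ρ', hρ', hP'⟩ := h N
    refine ⟨min ρ ρ', lt_min hρ hρ', fun n hn ↦ ?_⟩
    rcases Nat.lt_succ_iff_lt_or_eq.1 hn with hlt | rfl
    · exact hanti n ρ _ (min_le_left _ _) (hP n hlt)
    · exact hanti _ ρ' _ (min_le_right _ _) hP'

variable {D : DobrushinDomain} {φ : ConformalEquiv upperHalfPlaneSet D.carrier}
  {Ds : ℕ → DobrushinDomain} {φs : ∀ n, ConformalEquiv upperHalfPlaneSet (Ds n).carrier}

/-- **Uniform behaviour at infinity of a convergent family of boundary extensions.** If the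
boundary extensions `Φ_n` of chordal uniformizing maps of `(D_n; a_n, b_n)` satisfy (U2)
(`dist (Φ_n z) b_n ≤ ε` for `‖z‖ ≥ r(ε)` and large `n`), then for every `ρ > 0` there is ONE
radius `R` with `dist (Φ_n z) b_n < ρ` for `‖z‖ ≥ R`, `0 ≤ im z`, and ALL `n` (the finitely many
small `n` by `exists_forall_dist_boundaryExtension_lt`). [cite: KemppainenSmirnov2017, Cor. 1.8] -/
theorem exists_forall_dist_boundaryExtension_lt_of_varying
    (hφs : ∀ n, (Ds n).IsChordalUniformizing (φs n))
    (hU2 : ∀ ε : ℝ, 0 < ε → ∃ r : ℝ, ∀ᶠ n in atTop, ∀ z : ℂ, z ∈ {z : ℂ | 0 ≤ z.im} → r ≤ ‖z‖ →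
      dist ((φs n).boundaryExtension z) ((Ds n).pt 1) ≤ ε)
    {ρ : ℝ} (hρ : 0 < ρ) :
    ∃ R : ℝ, ∀ (n : ℕ) (z : ℂ), 0 ≤ z.im → R ≤ ‖z‖ →
      dist ((φs n).boundaryExtension z) ((Ds n).pt 1) < ρ := by
  obtain ⟨r, hr⟩ := hU2 (ρ / 2) (half_pos hρ)
  obtain ⟨N, hN⟩ := eventually_atTop.1 hr
  obtain ⟨R₀, hR₀⟩ := exists_forall_lt_of_forall_exists_of_monotone
    (P := fun n R ↦ ∀ z : ℂ, 0 ≤ z.im → R ≤ ‖z‖ →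
      dist ((φs n).boundaryExtension z) ((Ds n).pt 1) < ρ)
    (fun n R R' hRR' hP z hz hzR' ↦ hP z hz (hRR'.trans hzR'))
    (fun n ↦ (hφs n).exists_forall_dist_boundaryExtension_lt hρ) N
  refine ⟨max r R₀, fun n z hz hzR ↦ ?_⟩
  rcases lt_or_ge n N with hn | hn
  · exact hR₀ n hn z hz ((le_max_right _ _).trans hzR)
  · exact (hN n hn z hz ((le_max_left _ _).trans hzR)).trans_lt (half_lt_self hρ)

/-- **Uniform properness of a convergent family of boundary extensions.** If `Φ_n → Φ`
uniformly on every `{0 ≤ im} ∩ closedBall 0 R` ((U1)) and `b_n → b`, with `Φ` the boundary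
extension of a chordal uniformizing map of `(D; a, b)`, then for every `R` there is ONE `ρ > 0`
with `dist (Φ_n z) b_n ≥ ρ` for `‖z‖ ≤ R`, `0 ≤ im z`, and ALL `n`.
[cite: KemppainenSmirnov2017, Cor. 1.8] -/
theorem exists_forall_le_dist_boundaryExtension_of_varying (hφ : D.IsChordalUniformizing φ)
    (hφs : ∀ n, (Ds n).IsChordalUniformizing (φs n))
    (hU1 : ∀ R : ℝ, TendstoUniformlyOn (fun n ↦ (φs n).boundaryExtension) φ.boundaryExtension
      atTop ({z : ℂ | 0 ≤ z.im} ∩ closedBall 0 R))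
    (hb : Tendsto (fun n ↦ (Ds n).pt 1) atTop (𝓝 (D.pt 1))) (R : ℝ) :
    ∃ ρ : ℝ, 0 < ρ ∧ ∀ (n : ℕ) (z : ℂ), 0 ≤ z.im → ‖z‖ ≤ R →
      ρ ≤ dist ((φs n).boundaryExtension z) ((Ds n).pt 1) := by
  obtain ⟨ρ₀, hρ₀, hfar⟩ := hφ.exists_forall_le_dist_boundaryExtension R
  have h1 : ∀ᶠ n in atTop, ∀ z ∈ {z : ℂ | 0 ≤ z.im} ∩ closedBall (0 : ℂ) R,
      dist (φ.boundaryExtension z) ((φs n).boundaryExtension z) < ρ₀ / 4 :=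
    Metric.tendstoUniformlyOn_iff.1 (hU1 R) (ρ₀ / 4) (by positivity)
  have h2 : ∀ᶠ n in atTop, dist ((Ds n).pt 1) (D.pt 1) < ρ₀ / 4 :=
    Metric.tendsto_nhds.1 hb (ρ₀ / 4) (by positivity)
  obtain ⟨N, hN⟩ := eventually_atTop.1 (h1.and h2)
  obtain ⟨ρ₁, hρ₁, hsmall⟩ := exists_pos_forall_lt_of_forall_exists_of_antitone
    (P := fun n ρ ↦ ∀ z : ℂ, 0 ≤ z.im → ‖z‖ ≤ R →
      ρ ≤ dist ((φs n).boundaryExtension z) ((Ds n).pt 1))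
    (fun n ρ ρ' hρρ' hP z hz hzR ↦ hρρ'.trans (hP z hz hzR))
    (fun n ↦ (hφs n).exists_forall_le_dist_boundaryExtension R) N
  refine ⟨min (ρ₀ / 2) ρ₁, lt_min (half_pos hρ₀) hρ₁, fun n z hz hzR ↦ ?_⟩
  rcases lt_or_ge n N with hn | hn
  · exact (min_le_right _ _).trans (hsmall n hn z hz hzR)
  · obtain ⟨hn1, hn2⟩ := hN n hn
    have hz' : z ∈ {z : ℂ | 0 ≤ z.im} ∩ closedBall (0 : ℂ) R := ⟨hz, mem_closedBall_zero_iff.2 hzR⟩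
    have hA := hfar z hz hzR
    have hB := hn1 z hz'
    have hC : dist (φ.boundaryExtension z) (D.pt 1) ≤
        dist (φ.boundaryExtension z) ((φs n).boundaryExtension z) +
          dist ((φs n).boundaryExtension z) ((Ds n).pt 1) + dist ((Ds n).pt 1) (D.pt 1) :=
      dist_triangle4 _ _ _ _
    refine (min_le_left _ _).trans ?_
    linarith

end Family

/-! ### One regular curve: its Loewner pair, no return in capacity time, localised tip modulus -/

namespace LoewnerRegularity

/-- **Driving scales of a regularity**: thresholds `δW k > 0` with `drvMod (k+1) d ≤ 1/(k+1)` for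
`0 < d ≤ δW k` (the moduli `drvMod T` tend to `0` at `0⁺`). [folklore] -/
theorem exists_drvScale (𝔯 : LoewnerRegularity) :
    ∃ δW : ℕ → ℝ, (∀ k, 0 < δW k) ∧
      ∀ (k : ℕ) (d : ℝ), 0 < d → d ≤ δW k → 𝔯.drvMod (k + 1) d ≤ 1 / ((k : ℝ) + 1) := by
  have hk : ∀ k : ℕ, ∃ δ : ℝ, 0 < δ ∧
      ∀ d : ℝ, 0 < d → d ≤ δ → 𝔯.drvMod (k + 1) d ≤ 1 / ((k : ℝ) + 1) := by
    intro k
    have hpos : (0 : ℝ) < 1 / ((k : ℝ) + 1) := by positivity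
    have hev : ∀ᶠ d in 𝓝[>] (0 : ℝ), dist (𝔯.drvMod (k + 1) d) 0 < 1 / ((k : ℝ) + 1) :=
      Metric.tendsto_nhds.1 (𝔯.tendsto_drvMod (k + 1)) _ hpos
    rw [eventually_nhdsWithin_iff, Metric.eventually_nhds_iff] at hev
    obtain ⟨ε, hε, hεp⟩ := hev
    refine ⟨ε / 2, half_pos hε, fun d hd hdε ↦ ?_⟩
    have h1 : dist d 0 < ε := by
      rw [Real.dist_0_eq_abs, abs_of_pos hd]
      linarith
    have h2 := hεp h1 hd
    rw [Real.dist_0_eq_abs] at h2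
    exact (le_abs_self _).trans h2.le
  choose δW hδW hmod using hk
  exact ⟨δW, hδW, hmod⟩

/-- **Tip levels of a regularity**: for every level `k` an index `j k` whose localisation radius
`tipRad (j k)` is below the capacity radius `capRad (k+2)` (the radii `tipRad` accumulate at
`0`). [folklore] -/
theorem exists_tipLevel (𝔯 : LoewnerRegularity) :
    ∃ j : ℕ → ℕ, ∀ k, 𝔯.tipRad (j k) < 𝔯.capRad (k + 2) := by
  choose j hj using fun k ↦ 𝔯.exists_tipRad_lt _ (𝔯.capRad_pos (k + 2))
  exact ⟨j, hj⟩

end LoewnerRegularity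

namespace IsRegularCurve

variable {D : DobrushinDomain} {φ : ConformalEquiv upperHalfPlaneSet D.carrier}
  {𝔯 : LoewnerRegularity} {c : Curve ℂ}

/-- The Loewner chain of the transform `W = drivingFunction φ ⟦c⟧` of a regular curve is generated
by its trace. [cite: Lawler2005, §4.1 Prop. 4.4] -/
theorem isGeneratedByCurve_trace (hφ : D.IsChordalUniformizing φ) (h : IsRegularCurve φ 𝔯 c) :
    Loewner.IsGeneratedByCurve (drivingFunction φ (CurveClass.mk c))
      (Loewner.trace (drivingFunction φ (CurveClass.mk c))) :=
  (isLoewnerDescribed_drivingFunction (h.isLoewnerDescribable_mk hφ)).exists_eq_mk_trace.1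

/-- **The class of a regular curve is the compactified image of its trace**:
`⟦c⟧ = ⟦Φ ∘ γ̂⟧` (`compactifiedClass`). [cite: KemppainenSmirnov2017, §1.2] -/
theorem compactifiedClass_trace_eq (hφ : D.IsChordalUniformizing φ) (h : IsRegularCurve φ 𝔯 c) :
    compactifiedClass φ.boundaryExtension (D.pt 1)
        (Loewner.trace (drivingFunction φ (CurveClass.mk c))) = CurveClass.mk c := by
  obtain ⟨-, c', hc', hI⟩ :=
    (isLoewnerDescribed_drivingFunction (h.isLoewnerDescribable_mk hφ)).exists_eq_mk_trace
  rw [hI.compactifiedClass_eq, hc']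

/-- **The capacity schedule read downwards**: before capacity time `M` the `Φ`-image of the trace
is at distance `≥ capRad M` from `b` (contrapositive of `le_capacity`).
[cite: KemppainenSmirnov2017, §3.5] -/
theorem capRad_le_dist (h : IsRegularCurve φ 𝔯 c) {M : ℕ} {t : ℝ≥0} (ht : (t : ℝ) < M) :
    𝔯.capRad M ≤ dist (φ.boundaryExtension
      (Loewner.trace (drivingFunction φ (CurveClass.mk c)) t)) (D.pt 1) := by
  by_contra hlt
  push Not at hlt
  exact absurd (h.le_capacity M t hlt) (not_le.2 ht)

/-- **The tip modulus on a whole level.** If `tipRad j < capRad (k+2)`, the tip modulus of index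
`j` applies at every capacity time `s ≤ k+1` (the past is `capRad (k+2)`-far from `b` before
capacity `k+2`, `capRad_le_dist`): `‖f_s(W s + iy) - γ̂ s‖ ≤ tipMod j y` for
`0 < y ≤ tipDepth j`. [cite: KemppainenSmirnov2017, Thm. 3.10 and §3.5] -/
theorem tip_modulus_of_le (h : IsRegularCurve φ 𝔯 c) {j k : ℕ}
    (hj : 𝔯.tipRad j < 𝔯.capRad (k + 2)) {s : ℝ≥0} (hs : (s : ℝ) ≤ k + 1) {y : ℝ} (hy : 0 < y)
    (hy' : y ≤ 𝔯.tipDepth j) :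
    ‖Loewner.loewnerInv (drivingFunction φ (CurveClass.mk c)) s
        ((drivingFunction φ (CurveClass.mk c) s : ℂ) + y * Complex.I) -
      Loewner.trace (drivingFunction φ (CurveClass.mk c)) s‖ ≤ 𝔯.tipMod j y := by
  refine h.tip_modulus j s (fun t' ht' ↦ hj.le.trans (h.capRad_le_dist (M := k + 2) ?_)) y ⟨hy, hy'⟩
  have : ((t' : ℝ≥0) : ℝ) ≤ s := NNReal.coe_le_coe.2 ht'
  push_cast
  linarith

/-- **The driving path of a regular curve has the driving scales as moduli**:
`W = drivingFunction φ ⟦c⟧ ∈ Process.modulusSet {0} δW` for the scales of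
`LoewnerRegularity.exists_drvScale` (`W 0 = 0`, and on `[0, k+1]` the modulus `drvMod (k+1)`).
[cite: KemppainenSmirnov2017, Thm. 3.9 and §3.5] -/
theorem drivingPath_mem_modulusSet (hφ : D.IsChordalUniformizing φ) (h : IsRegularCurve φ 𝔯 c)
    {δW : ℕ → ℝ}
    (hδW : ∀ (k : ℕ) (d : ℝ), 0 < d → d ≤ δW k → 𝔯.drvMod (k + 1) d ≤ 1 / ((k : ℝ) + 1)) :
    (⟨drivingFunction φ (CurveClass.mk c), continuous_drivingFunction φ _⟩ : C(ℝ≥0, ℝ)) ∈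
      Process.modulusSet ({0} : Set ℝ) δW := by
  refine ⟨by simpa using h.drivingFunction_zero hφ, fun k s t hs ht hst ↦ ?_⟩
  simp only [ContinuousMap.coe_mk]
  rcases (dist_nonneg (x := s) (y := t)).eq_or_lt with hd | hd
  · have hst' : s = t := dist_eq_zero.1 hd.symm
    subst hst'
    rw [dist_self]
    positivity
  · have hsT : s ≤ ((k + 1 : ℕ) : ℝ≥0) := by
      have : ((s : ℝ≥0) : ℝ) ≤ ((k + 1 : ℕ) : ℝ≥0) := by push_cast; exact hs
      exact_mod_cast this
    have htT : t ≤ ((k + 1 : ℕ) : ℝ≥0) := by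
      have : ((t : ℝ≥0) : ℝ) ≤ ((k + 1 : ℕ) : ℝ≥0) := by push_cast; exact ht
      exact_mod_cast this
    exact (h.driving_modulus (k + 1) s t hsT htT).trans (hδW k _ hd hst)

/-- **No return near the target, in capacity time** (KS Prop. 3.2 (i) read on the trace). For a
regular curve with transform `W` and trace `γ̂`, `n > transIdx` and capacity times `s ≤ t`: if
`dist (Φ (γ̂ s)) b ≤ ρ_n` then `dist (Φ (γ̂ t)) b < ρ_{n-1}`. The capacity clock `θ` of the curve
(`exists_trace_drivingFunction_mk_eq_of_injOn`: continuous and increasing on `[0, 1)`, `θ 0 = 0`,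
`θ → ∞`, `Φ (γ̂ (θ u)) = c u`) carries the clause `transient` of the `[0, 1]`-parametrisation to
capacity time (intermediate values for `s ≤ t`). [cite: KemppainenSmirnov2017, Prop. 3.2 (i) and §3.5] -/
theorem trace_noReturn (hφ : D.IsChordalUniformizing φ) (h : IsRegularCurve φ 𝔯 c) {n : ℕ}
    (hn : 𝔯.transIdx < n) {s t : ℝ≥0} (hst : s ≤ t)
    (hs : dist (φ.boundaryExtension (Loewner.trace (drivingFunction φ (CurveClass.mk c)) s))
      (D.pt 1) ≤ 𝔯.transSeq n) :
    dist (φ.boundaryExtension (Loewner.trace (drivingFunction φ (CurveClass.mk c)) t)) (D.pt 1) <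
      𝔯.transSeq (n - 1) := by
  set W : ℝ≥0 → ℝ := drivingFunction φ (CurveClass.mk c) with hWdef
  obtain ⟨θ, hθc, -, hθ0, hθinf, htr⟩ := hφ.exists_trace_drivingFunction_mk_eq_of_injOn
    h.apply_zero h.apply_one h.mem_carrier h.injOn h.tendsto_im
  -- the value formula `Φ (γ̂ (θ u)) = c u` on `[0, 1)`
  have hval : ∀ (u : ℝ) (hu : u ∈ Ico (0 : ℝ) 1),
      φ.boundaryExtension (Loewner.trace W (θ u)) = c ⟨u, hu.1, hu.2.le⟩ := by
    intro u hu
    rcases hu.1.eq_or_lt with h0 | h0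
    · subst h0
      have hc0 : c ⟨0, hu.1, hu.2.le⟩ = D.pt 0 := by
        rw [← h.apply_zero]; rfl
      rw [hθ0, Loewner.trace_zero, hWdef, h.drivingFunction_zero hφ, Complex.ofReal_zero,
        hφ.boundaryExtension_zero, hc0]
    · have hu' : u ∈ Ioo (0 : ℝ) 1 := ⟨h0, hu.2⟩
      have hmem : c ⟨u, hu.1, hu.2.le⟩ ∈ D.carrier := h.mem_carrier _ h0 hu.2
      rw [hWdef, htr u hu', φ.boundaryExtension_eq (φ.symm_mapsTo hmem), φ.apply_symm_apply hmem]
  -- a parameter `u_t ∈ [0, 1)` of capacity `t`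
  obtain ⟨ut, hut, hutt⟩ : ∃ u ∈ Ico (0 : ℝ) 1, θ u = t := by
    have hev : ∀ᶠ v in 𝓝[<] (1 : ℝ), t ≤ θ v := hθinf.eventually (eventually_ge_atTop t)
    obtain ⟨v, hv, hvI⟩ := (hev.and (Ioo_mem_nhdsLT one_pos)).exists
    have hsub : Icc (0 : ℝ) v ⊆ Ico 0 1 := fun w hw ↦ ⟨hw.1, hw.2.trans_lt hvI.2⟩
    have hivt := intermediate_value_Icc hvI.1.le (hθc.mono hsub)
    rw [hθ0] at hivt
    obtain ⟨w, hw, hwt⟩ := hivt ⟨bot_le, hv⟩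
    exact ⟨w, ⟨hw.1, hw.2.trans_lt hvI.2⟩, hwt⟩
  -- a parameter `u_s ∈ [0, u_t]` of capacity `s`
  obtain ⟨us, hus, huss⟩ : ∃ u ∈ Icc (0 : ℝ) ut, θ u = s := by
    have hsub : Icc (0 : ℝ) ut ⊆ Ico 0 1 := fun w hw ↦ ⟨hw.1, hw.2.trans_lt hut.2⟩
    have hivt := intermediate_value_Icc hut.1 (hθc.mono hsub)
    rw [hθ0, hutt] at hivt
    exact hivt ⟨bot_le, hst⟩
  have husI : us ∈ Ico (0 : ℝ) 1 := ⟨hus.1, hus.2.trans_lt hut.2⟩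
  have key := h.transient n hn ⟨us, hus.1, husI.2.le⟩ ⟨ut, hut.1, hut.2.le⟩
    (Subtype.mk_le_mk.2 hus.2)
  rw [← hutt, hval ut hut]
  rw [← huss, hval us husI] at hs
  exact key hs

end IsRegularCurve

/-! ### Regular curves lie in one box, uniformly over a family of approximating domains -/

section Boxes

variable {D : DobrushinDomain} {φ : ConformalEquiv upperHalfPlaneSet D.carrier}
  {Ds : ℕ → DobrushinDomain} {φs : ∀ n, ConformalEquiv upperHalfPlaneSet (Ds n).carrier}

/-- **Regular curves lie in a Kemppainen–Smirnov box, uniformly over a family of domains.** Let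
`φ_n` be chordal uniformizing maps of `(D_n; a_n, b_n)` whose boundary extensions `Φ_n` behave
uniformly at infinity (`dist (Φ_n z) b_n < ρ` for `‖z‖ ≥ R(ρ)`, all `n`) and are uniformly
proper (`dist (Φ_n z) b_n ≥ ρ(R) > 0` for `‖z‖ ≤ R`, all `n`). Then for every regularity `𝔯`
there are moduli `δγ, δW > 0` and a transience profile `T` such that for ALL `n` every class of
`regularCurves (φ_n) 𝔯` is `⟦Φ_n ∘ γ̂⟧` for a Loewner pair `(γ̂, W)` (its trace and transform
through `φ_n`) with `γ̂ 0 = W 0 = 0`, moduli `δγ`, `δW` on every `[0, k+1]` and `‖γ̂ t‖ ≥ k`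
for `t ≥ T k` — the box of `isCompact_pairBox` / `LoewnerTransformContinuity.lean`. Moduli of
`W`: the driving scales; moduli of `γ̂`: the tip modulus localised by the capacity schedule, via
`Loewner.exists_modulusSet_of_tipModulus_levels`; transience: past capacity `144 R² + 1` the
trace has left `B̄(0, R)` (`exists_lt_norm_of_lt`), hence come `ρ_m`-close to `b_n` (uniformly
at infinity), hence stays `ρ_{m-1}`-close (`trace_noReturn`), hence stays outside `B̄(0, k)`
(uniform properness). [cite: KemppainenSmirnov2017, §3.5 and App. A Lemma A.5] -/
theorem exists_pairBox_of_regularCurves (hφs : ∀ n, (Ds n).IsChordalUniformizing (φs n))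
    (hinf : ∀ ρ : ℝ, 0 < ρ → ∃ R : ℝ, ∀ (n : ℕ) (z : ℂ), 0 ≤ z.im → R ≤ ‖z‖ →
      dist ((φs n).boundaryExtension z) ((Ds n).pt 1) < ρ)
    (hprop : ∀ R : ℝ, ∃ ρ : ℝ, 0 < ρ ∧ ∀ (n : ℕ) (z : ℂ), 0 ≤ z.im → ‖z‖ ≤ R →
      ρ ≤ dist ((φs n).boundaryExtension z) ((Ds n).pt 1))
    (𝔯 : LoewnerRegularity) :
    ∃ (δγ δW : ℕ → ℝ) (T : ℕ → ℝ≥0), (∀ k, 0 < δγ k) ∧ (∀ k, 0 < δW k) ∧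
      ∀ n, regularCurves (φs n) 𝔯 ⊆
        (fun p ↦ compactifiedClass (φs n).boundaryExtension ((Ds n).pt 1) p.1) ''
          {p : C(ℝ≥0, ℂ) × C(ℝ≥0, ℝ) | p ∈ generatedPairs ∧
            p.1 ∈ Process.modulusSet ({0} : Set ℂ) δγ ∧
            p.2 ∈ Process.modulusSet ({0} : Set ℝ) δW ∧
            ∀ (k : ℕ) (t : ℝ≥0), T k ≤ t → (k : ℝ) ≤ ‖p.1 t‖} := by
  -- moduli of the driving terms and of the curves
  obtain ⟨δW, hδW, hdrv⟩ := 𝔯.exists_drvScale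
  obtain ⟨j, hj⟩ := 𝔯.exists_tipLevel
  obtain ⟨δγ, hδγ, hcurve⟩ := Loewner.exists_modulusSet_of_tipModulus_levels hδW
    (ψ := fun k ↦ 𝔯.tipMod (j k)) (fun k ↦ 𝔯.tendsto_tipMod (j k))
    (y₀ := fun k ↦ 𝔯.tipDepth (j k)) (fun k ↦ 𝔯.tipDepth_pos (j k))
  -- the transience profile
  have hT : ∀ k : ℕ, ∃ Tk : ℝ≥0, ∀ (n : ℕ) (c : Curve ℂ), IsRegularCurve (φs n) 𝔯 c →
      ∀ t : ℝ≥0, Tk ≤ t →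
        (k : ℝ) ≤ ‖Loewner.trace (drivingFunction (φs n) (CurveClass.mk c)) t‖ := by
    intro k
    obtain ⟨ρ', hρ', hpropk⟩ := hprop k
    obtain ⟨m₀, hm₀⟩ := eventually_atTop.1 ((tendsto_order.1 𝔯.tendsto_transSeq).2 ρ' hρ')
    set m : ℕ := max m₀ 𝔯.transIdx + 1 with hmdef
    have hmidx : 𝔯.transIdx < m := Nat.lt_succ_of_le (le_max_right _ _)
    have hm1 : 𝔯.transSeq (m - 1) < ρ' := hm₀ (m - 1) (by simp [hmdef])
    obtain ⟨R, hR⟩ := hinf (𝔯.transSeq m) (𝔯.transSeq_pos m)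
    set R' : ℝ := max R 1 with hR'def
    have hR'pos : 0 < R' := lt_of_lt_of_le one_pos (le_max_right _ _)
    refine ⟨⟨144 * R' ^ 2 + 1, by positivity⟩, fun n c hc t ht ↦ ?_⟩
    set W : ℝ≥0 → ℝ := drivingFunction (φs n) (CurveClass.mk c) with hWdef
    have hgen := hc.isGeneratedByCurve_trace (hφs n)
    have ht' : 144 * R' ^ 2 < (t : ℝ) := by
      have h1 : ((⟨144 * R' ^ 2 + 1, by positivity⟩ : ℝ≥0) : ℝ) ≤ t := NNReal.coe_le_coe.2 ht
      exact lt_of_lt_of_le (by linarith) h1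
    obtain ⟨s, hst, hsR⟩ :=
      hgen.exists_lt_norm_of_lt (continuous_drivingFunction _ _) hR'pos ht'
    have h1 : dist ((φs n).boundaryExtension (Loewner.trace W s)) ((Ds n).pt 1) < 𝔯.transSeq m :=
      hR n _ (hgen.im_nonneg s) ((le_max_left _ _).trans hsR.le)
    have h2 := hc.trace_noReturn (hφs n) hmidx hst h1.le
    by_contra hk
    push Not at hk
    have h3 := hpropk n (Loewner.trace W t) (hgen.im_nonneg t) hk.le
    linarith
  choose T hT using hT
  refine ⟨δγ, δW, T, hδγ, hδW, fun n ↦ ?_⟩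
  rintro x ⟨c, rfl, hc⟩
  set W : ℝ≥0 → ℝ := drivingFunction (φs n) (CurveClass.mk c) with hWdef
  have hgen := hc.isGeneratedByCurve_trace (hφs n)
  set p : C(ℝ≥0, ℂ) × C(ℝ≥0, ℝ) :=
    (⟨Loewner.trace W, hgen.continuous⟩, ⟨W, continuous_drivingFunction _ _⟩) with hpdef
  have hW : p.2 ∈ Process.modulusSet ({0} : Set ℝ) δW := hc.drivingPath_mem_modulusSet (hφs n) hdrv
  refine ⟨p, ⟨hgen, ?_, hW, fun k t ht ↦ hT k n c hc t ht⟩, hc.compactifiedClass_trace_eq (hφs n)⟩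
  refine hcurve p.2 p.1 hW (fun k s hs y hy hy' ↦ ?_) ?_
  · exact hc.tip_modulus_of_le (hj k) hs hy hy'
  · show Loewner.trace W 0 = 0
    rw [Loewner.trace_zero, hWdef, hc.drivingFunction_zero (hφs n), Complex.ofReal_zero]

/-- **Regular curves of one domain lie in a box** (the family constant in `n`): for a chordal
uniformizing map `φ` of `(D; a, b)` and every regularity `𝔯`,
`regularCurves φ 𝔯 ⊆ ⟦Φ ∘ pr₁⟧ '' box (δγ, δW, T)` for suitable moduli and transience profile —
so the event form of KS §3.5 (`LoewnerRegularCurves.lean`) is a case of the box form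
(`LoewnerTransformContinuity.lean`). [cite: KemppainenSmirnov2017, §3.5 and App. A Lemma A.5] -/
theorem regularCurves_subset_image_pairBox (hφ : D.IsChordalUniformizing φ) (𝔯 : LoewnerRegularity) :
    ∃ (δγ δW : ℕ → ℝ) (T : ℕ → ℝ≥0), (∀ k, 0 < δγ k) ∧ (∀ k, 0 < δW k) ∧
      regularCurves φ 𝔯 ⊆
        (fun p ↦ compactifiedClass φ.boundaryExtension (D.pt 1) p.1) ''
          {p : C(ℝ≥0, ℂ) × C(ℝ≥0, ℝ) | p ∈ generatedPairs ∧
            p.1 ∈ Process.modulusSet ({0} : Set ℂ) δγ ∧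
            p.2 ∈ Process.modulusSet ({0} : Set ℝ) δW ∧
            ∀ (k : ℕ) (t : ℝ≥0), T k ≤ t → (k : ℝ) ≤ ‖p.1 t‖} := by
  obtain ⟨δγ, δW, T, h1, h2, h3⟩ := exists_pairBox_of_regularCurves (Ds := fun _ ↦ D)
    (φs := fun _ ↦ φ) (fun _ ↦ hφ)
    (fun ρ hρ ↦ (hφ.exists_forall_dist_boundaryExtension_lt hρ).imp fun R hR _ ↦ hR)
    (fun R ↦ (hφ.exists_forall_le_dist_boundaryExtension R).imp fun ρ hρ ↦ ⟨hρ.1, fun _ ↦ hρ.2⟩) 𝔯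
  exact ⟨δγ, δW, T, h1, h2, h3 0⟩

/-! ### Kemppainen–Smirnov's theorem in the event form, for approximating domains -/

/-- **Kemppainen–Smirnov's Thm. 1.5 (ii)–(iii) with Cor. 1.7–1.8, event form, approximating
domains.** Let `(D_n; a_n, b_n)`, `(D; a, b)` be Dobrushin domains with chordal uniformizing maps
`φ_n`, `φ` whose boundary extensions converge uniformly on the compacts
`{0 ≤ im} ∩ closedBall 0 R` ((U1)) and uniformly at infinity ((U2)), with `b_n → b`; let
probability laws `μs n` on curve classes converge weakly to `ν`. Suppose that for every `ε > 0`
there is a regularity `𝔯` with `μs n (regularCurves (φ_n) 𝔯)ᶜ ≤ ε` for ALL `n` — the curves under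
`μs n` are regular simple chordal curves OF `(D_n; a_n, b_n)` with tight regularity parameters
(KS Prop. 3.2 / Thms. 3.9, 3.10 for the family `(φ_n, μs n)`: the probabilistic half, not in this
file). Then `ν`-a.e. curve class is described by the Loewner evolution through `φ`, and the
discrete driving processes `V n u c = drivingFunction (φ_n) c u` on `(CurveClass ℂ, μs n)`
(CDHKS's `w^δ`) converge in distribution on `C([0, ∞), ℝ)` to the driving function through `φ`
under `ν`. PROVED: `exists_pairBox_of_regularCurves` (with the uniform properties from (U1), (U2))
and `ae_isLoewnerDescribable_and_tendstoInDistribution_drivingPath_varying`.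
[cite: KemppainenSmirnov2017, Thm. 1.5, Cor. 1.7, Cor. 1.8, §3.5] [cite: CDHKSCRAS2014, Thm. 3 and §3] -/
theorem ae_isLoewnerDescribable_and_tendstoInDistribution_of_regularCurves_varying
    (hφ : D.IsChordalUniformizing φ) (hφs : ∀ n, (Ds n).IsChordalUniformizing (φs n))
    (hU1 : ∀ R : ℝ, TendstoUniformlyOn (fun n ↦ (φs n).boundaryExtension) φ.boundaryExtension
      atTop ({z : ℂ | 0 ≤ z.im} ∩ closedBall 0 R))
    (hU2 : ∀ ε : ℝ, 0 < ε → ∃ r : ℝ, ∀ᶠ n in atTop, ∀ z : ℂ, z ∈ {z : ℂ | 0 ≤ z.im} → r ≤ ‖z‖ →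
      dist ((φs n).boundaryExtension z) ((Ds n).pt 1) ≤ ε)
    (hb : Tendsto (fun n ↦ (Ds n).pt 1) atTop (𝓝 (D.pt 1)))
    {μs : ℕ → Measure (CurveClass ℂ)} [∀ n, IsProbabilityMeasure (μs n)]
    {ν : Measure (CurveClass ℂ)} [IsProbabilityMeasure ν]
    (hlim : ∀ f : CurveClass ℂ →ᵇ ℝ, Tendsto (fun n ↦ ∫ c, f c ∂μs n) atTop (𝓝 (∫ c, f c ∂ν)))
    (h : ∀ ε : ℝ≥0∞, 0 < ε → ∃ 𝔯 : LoewnerRegularity, ∀ n, μs n (regularCurves (φs n) 𝔯)ᶜ ≤ ε) :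
    (∀ᵐ c ∂ν, IsLoewnerDescribable φ c) ∧
      TendstoInDistribution
        (fun (n : ℕ) (c : CurveClass ℂ) ↦
          (⟨fun u ↦ drivingFunction (φs n) c u, continuous_drivingFunction (φs n) c⟩ : C(ℝ≥0, ℝ)))
        atTop (fun c ↦ (⟨drivingFunction φ c, continuous_drivingFunction φ c⟩ : C(ℝ≥0, ℝ))) μs ν := by
  have hinf := fun ρ (hρ : (0 : ℝ) < ρ) ↦ exists_forall_dist_boundaryExtension_lt_of_varying hφs hU2 hρ
  have hprop := exists_forall_le_dist_boundaryExtension_of_varying hφ hφs hU1 hb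
  refine ae_isLoewnerDescribable_and_tendstoInDistribution_drivingPath_varying hφ hφs hU1 hU2 hb
    hlim fun ε hε ↦ ?_
  obtain ⟨𝔯, h𝔯⟩ := h ε hε
  obtain ⟨δγ, δW, T, hδγ, hδW, hbox⟩ := exists_pairBox_of_regularCurves hφs hinf hprop 𝔯
  exact ⟨δγ, δW, T, hδγ, hδW, fun n ↦ (measure_mono (compl_subset_compl.2 (hbox n))).trans (h𝔯 n)⟩

end Boxes

end Literature.Probability.RandomPlanarGeometry
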